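import Literature.NumberTheory.Automorphic.U3PrincipalSeriesLettersUnfold        -- ★ `U3SquareIntegrableExponents_iff` (N5 theorem-world bridge)
import Literature.NumberTheory.Automorphic.CasselmanCriterionRankOne            -- ★ R4-asm ED. 1–4 (generic criterion, exponent form)
import Literature.NumberTheory.Automorphic.CMBorelAdmissibleTorusRay            -- (ED. 2) ★ p833860 (F0P3a-p04): N5's three conditions ↔ the ray `d(α, 1, (σ_w α)⁻¹)`
import Literature.NumberTheory.Automorphic.CMBorelIwahoriShellBound             -- (ED. 2) ★ (F0P3-p01): closed torus, upper shell bound, square of the uniformiser ray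
import Literature.NumberTheory.Automorphic.DoubleCosetShellVolumeLowerBound     -- (ED. 2) ★ R3f (B-p04): lower shell bound, `norm_rootDeltaChar_sq_mul_modularCharacter_inv`
import Literature.NumberTheory.Automorphic.CMPrincipalSeriesSpherical           -- (ED. 2) ★ `rootDeltaChar_eq_one_of_mem_of_isClosed_of_isCompact`
import Summits.HodgeConjecture.HodgeConjecture.Theorems.F0P3bCentralCharacterUnitaryNonsplit  -- (ED. 2) ★ `isCompact_center_cmLocal_of_nonsplit`
import Summits.HodgeConjecture.HodgeConjecture.Theorems.F0P3CMBorelIwahoriDatum  -- (ED. 2) ★ p834017 (B-p04): (T1)∕(T2) `exists_cmIwahoriDatum(_cartan)`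
import HarnessLib

/-!
# Crux `H413` — N5 ★ `UnitaryGroup.U3SquareIntegrableExponents L` (Casselman's square-integrability criterion for `U(3)(L⁺_v)`): THE ASSEMBLY
# (R6 of the N5 road) — ED. 1: the def-letter bridge and the per-place reduction to the two directions

Cell `hodgecm-mathlib`, F0∕P3, crux item stmt-HodgeConjecture-24833; Keys pay-down line `stub_casselmanCriterion` (N5, letter #109).  Seat F0P3-p01 (g10),
road lead; `--supports stmt-HodgeConjecture-24833 --as helper`; theorems only, no `def`, no named fact, no instance, no `sorry`.  HONEST LABEL: HC_CM
is proved only modulo the printed citations until rung 0 closes; this edition proves N5 from TWO per-place named hypotheses `hfwd` ∕ `hbwd` (the two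
directions at a fixed non-split place, a fixed Haar measure, a fixed admissible `π` with central character), which the next edition discharges from
★ `CasselmanCriterionRankOne` ED. 3∕4 + ★ B-p04 `F0P3CMBorelIwahoriDatum` (T1)∕(T2) + ★ F0P3a-p04 `CMBorelAdmissibleTorusRay`.  The point of ED. 1 is to
cross the def-letter wall once (★ `U3SquareIntegrableExponents_iff`, `Iff.rfl` at 4·10⁶ heartbeats) and to fix the two sockets token-exactly.

## References
* [Casselman1995] W. Casselman, *Introduction to the theory of admissible representations of `p`-adic reductive groups* (draft 1 May 1995),
  Thm. 4.4.6 p. 45.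
* [Rogawski1990] J. D. Rogawski, *Automorphic Representations of Unitary Groups in Three Variables*, §12.2 (2) p. 174.
-/

set_option autoImplicit false
-- the mandated namespace repeats `HodgeConjecture.HodgeConjecture`, as in every `Theorems/*.lean` of this sub-problem
set_option linter.dupNamespace false

noncomputable section

open MeasureTheory NumberField IsDedekindDomain
open Literature.NumberTheory.Automorphic Literature.NumberTheory.Automorphic.UnitaryGroup
open scoped NNReal

namespace Summit.HodgeConjecture.HodgeConjecture.Cruxes.H413.F0P3U3SquareIntegrableExponentsHolds

variable (L : Type) [Field L] [NumberField L] [IsCMField L]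

set_option synthInstance.maxHeartbeats 400000 in
set_option maxHeartbeats 4000000 in
/-- **N5 FROM ITS TWO DIRECTIONS AT EACH NON-SPLIT PLACE** (the sockets of R6): if at every non-split `v`, for every Haar measure `μZ` on `G ⧸ Z`,
every admissible `π` with central character `ω` of modulus one, (fwd) square-integrability modulo the centre implies the exponent decay
`‖χ'(a)‖ < 1` for every exponent `χ'` and every `a = d(α, 1, ᾱ⁻¹)`, `α ∈ F_v`, `‖α‖ < 1`, and (bwd) conversely, then ★ `U3SquareIntegrableExponents L`
holds (★ `U3SquareIntegrableExponents_iff`). [cite: Casselman1995, Thm. 4.4.6 p. 45] [cite: Rogawski1990, §12.2 (2) p. 174] -/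
theorem u3SquareIntegrableExponents_of_perPlace
    (hfwd : ∀ (v : HeightOneSpectrum (𝓞 ↥(maximalRealSubfield L))),
      (∀ w : PlacesOver L v, IsCMField.complexConj L • w.1 = w.1) →
      ∀ [MeasurableSpace
            (↥(unitaryGroupOfForm (conjLocal L (IsCMField.complexConj L) v) (cmLocalForm L 3 v)) ⧸
              Subgroup.center ↥(unitaryGroupOfForm (conjLocal L (IsCMField.complexConj L) v) (cmLocalForm L 3 v)))]
        [BorelSpace
            (↥(unitaryGroupOfForm (conjLocal L (IsCMField.complexConj L) v) (cmLocalForm L 3 v)) ⧸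
              Subgroup.center ↥(unitaryGroupOfForm (conjLocal L (IsCMField.complexConj L) v) (cmLocalForm L 3 v)))]
        (μZ : Measure
            (↥(unitaryGroupOfForm (conjLocal L (IsCMField.complexConj L) v) (cmLocalForm L 3 v)) ⧸
              Subgroup.center ↥(unitaryGroupOfForm (conjLocal L (IsCMField.complexConj L) v) (cmLocalForm L 3 v))))
        [μZ.IsHaarMeasure],
      ∀ (V : Type) [AddCommGroup V] [Module ℂ V]
        (π : Representation ℂ ↥(unitaryGroupOfForm (conjLocal L (IsCMField.complexConj L) v) (cmLocalForm L 3 v)) V),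
        π.IsAdmissible →
      ∀ (ω : ↥(Subgroup.center ↥(unitaryGroupOfForm (conjLocal L (IsCMField.complexConj L) v) (cmLocalForm L 3 v))) →* ℂˣ),
        (∀ (z : ↥(Subgroup.center ↥(unitaryGroupOfForm (conjLocal L (IsCMField.complexConj L) v) (cmLocalForm L 3 v)))) (x : V),
          π (z : ↥(unitaryGroupOfForm (conjLocal L (IsCMField.complexConj L) v) (cmLocalForm L 3 v))) x = ((ω z : ℂˣ) : ℂ) • x) →
        (∀ z, ‖((ω z : ℂˣ) : ℂ)‖ = 1) →
      haveI := locallyCompactSpace_cmBorelU L 3 v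
      π.IsSquareIntegrableModCenter μZ →
        ∀ χ' : ↥(cmBorelTriple L 3 v).M →* ℂˣ, π.HasJacquetExponent (cmBorelTriple L 3 v) χ' →
          ∀ a : ↥(cmBorelTriple L 3 v).M,
            conjLocal L (IsCMField.complexConj L) v
                ((torusEntry (conjLocal L (IsCMField.complexConj L) v) (cmLocalForm L 3 v) 0 a : (LocalRing L v)ˣ) : LocalRing L v) =
              ((torusEntry (conjLocal L (IsCMField.complexConj L) v) (cmLocalForm L 3 v) 0 a : (LocalRing L v)ˣ) : LocalRing L v) →
            torusEntry (conjLocal L (IsCMField.complexConj L) v) (cmLocalForm L 3 v) 1 a = 1 →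
            unitModulusChar (LocalRing L v) (torusEntry (conjLocal L (IsCMField.complexConj L) v) (cmLocalForm L 3 v) 0 a) < 1 →
            ‖((χ' a : ℂˣ) : ℂ)‖ < 1)
    (hbwd : ∀ (v : HeightOneSpectrum (𝓞 ↥(maximalRealSubfield L))),
      (∀ w : PlacesOver L v, IsCMField.complexConj L • w.1 = w.1) →
      ∀ [MeasurableSpace
            (↥(unitaryGroupOfForm (conjLocal L (IsCMField.complexConj L) v) (cmLocalForm L 3 v)) ⧸
              Subgroup.center ↥(unitaryGroupOfForm (conjLocal L (IsCMField.complexConj L) v) (cmLocalForm L 3 v)))]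
        [BorelSpace
            (↥(unitaryGroupOfForm (conjLocal L (IsCMField.complexConj L) v) (cmLocalForm L 3 v)) ⧸
              Subgroup.center ↥(unitaryGroupOfForm (conjLocal L (IsCMField.complexConj L) v) (cmLocalForm L 3 v)))]
        (μZ : Measure
            (↥(unitaryGroupOfForm (conjLocal L (IsCMField.complexConj L) v) (cmLocalForm L 3 v)) ⧸
              Subgroup.center ↥(unitaryGroupOfForm (conjLocal L (IsCMField.complexConj L) v) (cmLocalForm L 3 v))))
        [μZ.IsHaarMeasure],
      ∀ (V : Type) [AddCommGroup V] [Module ℂ V]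
        (π : Representation ℂ ↥(unitaryGroupOfForm (conjLocal L (IsCMField.complexConj L) v) (cmLocalForm L 3 v)) V),
        π.IsAdmissible →
      ∀ (ω : ↥(Subgroup.center ↥(unitaryGroupOfForm (conjLocal L (IsCMField.complexConj L) v) (cmLocalForm L 3 v))) →* ℂˣ),
        (∀ (z : ↥(Subgroup.center ↥(unitaryGroupOfForm (conjLocal L (IsCMField.complexConj L) v) (cmLocalForm L 3 v)))) (x : V),
          π (z : ↥(unitaryGroupOfForm (conjLocal L (IsCMField.complexConj L) v) (cmLocalForm L 3 v))) x = ((ω z : ℂˣ) : ℂ) • x) →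
        (∀ z, ‖((ω z : ℂˣ) : ℂ)‖ = 1) →
      haveI := locallyCompactSpace_cmBorelU L 3 v
      (∀ χ' : ↥(cmBorelTriple L 3 v).M →* ℂˣ, π.HasJacquetExponent (cmBorelTriple L 3 v) χ' →
          ∀ a : ↥(cmBorelTriple L 3 v).M,
            conjLocal L (IsCMField.complexConj L) v
                ((torusEntry (conjLocal L (IsCMField.complexConj L) v) (cmLocalForm L 3 v) 0 a : (LocalRing L v)ˣ) : LocalRing L v) =
              ((torusEntry (conjLocal L (IsCMField.complexConj L) v) (cmLocalForm L 3 v) 0 a : (LocalRing L v)ˣ) : LocalRing L v) →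
            torusEntry (conjLocal L (IsCMField.complexConj L) v) (cmLocalForm L 3 v) 1 a = 1 →
            unitModulusChar (LocalRing L v) (torusEntry (conjLocal L (IsCMField.complexConj L) v) (cmLocalForm L 3 v) 0 a) < 1 →
            ‖((χ' a : ℂˣ) : ℂ)‖ < 1) →
        π.IsSquareIntegrableModCenter μZ) :
    U3SquareIntegrableExponents L := by
  refine (U3SquareIntegrableExponents_iff L).2 fun v hns _ _ μZ _ V _ _ π hπ ω hω => ?_
  constructor
  · rintro ⟨hω1, hsq⟩
    exact ⟨hω1, hfwd v hns μZ V π hπ ω hω hω1 hsq⟩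
  · rintro ⟨hω1, hexp⟩
    exact ⟨hω1, hbwd v hns μZ V π hπ ω hω hω1 hexp⟩

end Summit.HodgeConjecture.HodgeConjecture.Cruxes.H413.F0P3U3SquareIntegrableExponentsHolds

end

/-!
# ED. 2 — N5 PROVED: `u3SquareIntegrableExponents_holds : UnitaryGroup.U3SquareIntegrableExponents L`

The two sockets of ED. 1 discharged at every non-split `v` (one place `w ∣ v`, `c • w = w`, one-place model `e : U(Φ₃)(L⁺_v) ≃ₜ* U(σ_w, Φ₃)(L_w)`):
`perPlace_fwd` («⇒»: the ray shape of an admissible torus element ★ `coe_localNonsplitEquiv_eq_diagonal`, the CM Iwahori datum ★ (T1)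
`exists_cmIwahoriDatum`, the lower shell bound ★ `exists_pos_mul_modularCharacter_inv_pow_le_measureReal_cmBorel`, the criterion ★
`Representation.norm_exponent_lt_one_of_isSquareIntegrableModCenter`), `perPlace_bwd` («⇐»: uniformiser ray, ★ (T2) `exists_cmIwahoriDatum_cartan`,
the square `a² = b·k` ★ `exists_sq_eq_mul_of_coe_localNonsplitEquiv_eq_diagonal`, the upper shell bound ★ `measure_image_shell_le_cmIwahoriDatum`, the
criterion ★ `Representation.isSquareIntegrableModCenter_of_forall_norm_exponent_lt_one_of_sq` — ramified places and residue characteristic `2` included),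
and **`u3SquareIntegrableExponents_holds`** (ED. 1's `u3SquareIntegrableExponents_of_perPlace` fed with the two).  Default heartbeats.  HONEST LABEL:
HC_CM is proved only modulo the printed citations until rung 0 closes; this edition closes letter #109 (N5) of the books with axioms ⊆ the trio,
`--supports stmt-HodgeConjecture-24833 --as helper`.
-/

noncomputable section

open MeasureTheory Measure NumberField IsDedekindDomain
open Literature.NumberTheory.Automorphic Literature.NumberTheory.Automorphic.UnitaryGroup
open scoped NNReal ENNReal Pointwise MatrixGroups

namespace Summit.HodgeConjecture.HodgeConjecture.Cruxes.H413.F0P3U3SquareIntegrableExponentsHolds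

variable (L : Type) [Field L] [NumberField L] [IsCMField L] (v : HeightOneSpectrum (𝓞 ↥(maximalRealSubfield L)))

/-! ## §2 (ED. 2) The two directions at a non-split place, and N5 -/

/-- **N5 «⇒» AT A NON-SPLIT PLACE**: for an admissible `π` of `U(Φ₃)(L⁺_v)`, square-integrable modulo the centre (no central character needed), every
exponent `χ'` of `π` along `B` decays on every admissible torus element `a` (`σ(a₀₀) = a₀₀`, `a₁₁ = 1`, `‖a₀₀‖ < 1`): `‖χ'(a)‖ < 1`.  Assembly: the ray shape
`e a = d(α, 1, (σ_w α)⁻¹)`, `0 < |α|_w < 1` (★ `coe_localNonsplitEquiv_eq_diagonal`, ★ `v_torusEntry_apply_lt_one`, ★ `torusEntry_apply_ne_zero`), the CM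
Iwahori datum along `a` (★ (T1) `exists_cmIwahoriDatum`), the lower shell bound per level (★ `exists_pos_mul_modularCharacter_inv_pow_le_measureReal_cmBorel`,
compact centre ★ `isCompact_center_cmLocal_of_nonsplit`), `‖δ^{1/2}(a)‖² Δ(a)⁻¹ = 1` (★ `norm_rootDeltaChar_sq_mul_modularCharacter_inv`) and the criterion
★ `Representation.norm_exponent_lt_one_of_isSquareIntegrableModCenter`. [cite: Casselman1995, Thm. 4.4.6 p. 45] [cite: Rogawski1990, §12.2 (2) p. 174] -/
theorem perPlace_fwd (hns : ∀ w : PlacesOver L v, IsCMField.complexConj L • w.1 = w.1)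
    [MeasurableSpace
        (↥(unitaryGroupOfForm (conjLocal L (IsCMField.complexConj L) v) (cmLocalForm L 3 v)) ⧸
          Subgroup.center ↥(unitaryGroupOfForm (conjLocal L (IsCMField.complexConj L) v) (cmLocalForm L 3 v)))]
    [BorelSpace
        (↥(unitaryGroupOfForm (conjLocal L (IsCMField.complexConj L) v) (cmLocalForm L 3 v)) ⧸
          Subgroup.center ↥(unitaryGroupOfForm (conjLocal L (IsCMField.complexConj L) v) (cmLocalForm L 3 v)))]
    (μZ : Measure
        (↥(unitaryGroupOfForm (conjLocal L (IsCMField.complexConj L) v) (cmLocalForm L 3 v)) ⧸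
          Subgroup.center ↥(unitaryGroupOfForm (conjLocal L (IsCMField.complexConj L) v) (cmLocalForm L 3 v))))
    [μZ.IsHaarMeasure] (V : Type) [AddCommGroup V] [Module ℂ V]
    (π : Representation ℂ ↥(unitaryGroupOfForm (conjLocal L (IsCMField.complexConj L) v) (cmLocalForm L 3 v)) V) (hπ : π.IsAdmissible) :
    haveI := locallyCompactSpace_cmBorelU L 3 v
    π.IsSquareIntegrableModCenter μZ →
      ∀ χ' : ↥(cmBorelTriple L 3 v).M →* ℂˣ, π.HasJacquetExponent (cmBorelTriple L 3 v) χ' →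
        ∀ a : ↥(cmBorelTriple L 3 v).M,
          conjLocal L (IsCMField.complexConj L) v
              ((torusEntry (conjLocal L (IsCMField.complexConj L) v) (cmLocalForm L 3 v) 0 a : (UnitaryGroup.LocalRing L v)ˣ) : UnitaryGroup.LocalRing L v) =
            ((torusEntry (conjLocal L (IsCMField.complexConj L) v) (cmLocalForm L 3 v) 0 a : (UnitaryGroup.LocalRing L v)ˣ) : UnitaryGroup.LocalRing L v) →
          torusEntry (conjLocal L (IsCMField.complexConj L) v) (cmLocalForm L 3 v) 1 a = 1 →
          unitModulusChar (UnitaryGroup.LocalRing L v) (torusEntry (conjLocal L (IsCMField.complexConj L) v) (cmLocalForm L 3 v) 0 a) < 1 →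
          ‖((χ' a : ℂˣ) : ℂ)‖ < 1 := by
  intro hsq χ' hχ a _hfix h1 hlt
  haveI := locallyCompactSpace_cmBorelU L 3 v
  haveI : LocallyCompactSpace ↥(unitaryGroupOfForm (conjLocal L (IsCMField.complexConj L) v) (cmLocalForm L 3 v)) := locallyCompactSpace_local (IsCMField.complexConj L) 3 _ v
  obtain ⟨w⟩ := (inferInstance : Nonempty (PlacesOver L v))
  have hw : IsCMField.complexConj L • w.1 = w.1 := hns w
  -- the ray shape of `a` in the one-place model at `w`
  have hmat := coe_localNonsplitEquiv_eq_diagonal L v w hw a h1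
  have hα0 := torusEntry_apply_ne_zero L v w a
  have hα1 := v_torusEntry_apply_lt_one L v w hw a hlt
  -- the CM Iwahori datum along `a` (T1)
  obtain ⟨𝓘, K₀, ha𝓘, -, -, -, -, -, haN, haNbar, hexh, -, hdisj, -⟩ :=
    F0P3CMBorelIwahoriDatum.exists_cmIwahoriDatum L v w hw a hα0 hα1 hmat
  -- a Haar measure on `G` and the compact centre
  letI : MeasurableSpace ↥(unitaryGroupOfForm (conjLocal L (IsCMField.complexConj L) v) (cmLocalForm L 3 v)) := borel _
  haveI : BorelSpace ↥(unitaryGroupOfForm (conjLocal L (IsCMField.complexConj L) v) (cmLocalForm L 3 v)) := ⟨rfl⟩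
  have hZ := F0P3bCentralCharacterUnitaryNonsplit.isCompact_center_cmLocal_of_nonsplit L 3 v hns
  have key := Representation.norm_exponent_lt_one_of_isSquareIntegrableModCenter μZ hπ hsq (cmBorelTriple L 3 v) 𝓘
    (isClosed_cmBorelTriple_N L v) haN haNbar hexh
    (D := ((modularCharacter (⟨𝓘.a, (cmBorelTriple L 3 v).M_le 𝓘.a_mem⟩ : ↥(cmBorelTriple L 3 v).P) : ℝ≥0) : ℝ)⁻¹)
    (inv_nonneg.2 (NNReal.coe_nonneg _))
    (fun n => exists_pos_mul_modularCharacter_inv_pow_le_measureReal_cmBorel L v hZ Measure.haar μZ (𝓘.K n) (𝓘.isOpen_K n)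
      (𝓘.isCompact_K n) ⟨𝓘.a, 𝓘.a_mem⟩ (haN n))
    hdisj (norm_rootDeltaChar_sq_mul_modularCharacter_inv _ _) hχ
  have hsub : (⟨𝓘.a, 𝓘.a_mem⟩ : ↥(cmBorelTriple L 3 v).M) = a := Subtype.ext ha𝓘
  rw [hsub] at key
  exact key

/-- **N5 «⇐» AT A NON-SPLIT PLACE**: if every exponent of the admissible `π` (central character `ω` of modulus one) decays on every admissible torus
element, then `π` is square-integrable modulo the centre.  Assembly: a uniformiser `ϖ` of `L_w` (Mathlib `valuation_exists_uniformizer`), the torus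
ray `a` with `e a = d(ϖ, 1, (σ_w ϖ)⁻¹)` (★ `exists_torus_coe_localNonsplitEquiv_eq_diagonal`), the CM Iwahori datum along `a` WITH the Cartan decomposition
(★ (T2) `exists_cmIwahoriDatum_cartan`), the square `a² = b·k` with `b` admissible and `k ∈ K₀` (★ `exists_sq_eq_mul_of_coe_localNonsplitEquiv_eq_diagonal`, ★
`n5Conditions_of_coe_localNonsplitEquiv_eq_diagonal`), `δ^{1/2}(k) = 1` (★ `rootDeltaChar_eq_one_of_mem_of_isClosed_of_isCompact`), the upper shell bound
(★ `measure_image_shell_le_cmIwahoriDatum`) and the criterion ★ `Representation.isSquareIntegrableModCenter_of_forall_norm_exponent_lt_one_of_sq` (ramified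
and residue characteristic `2` included). [cite: Casselman1995, Thm. 4.4.6 p. 45] [cite: Rogawski1990, §12.2 (2) p. 174] -/
theorem perPlace_bwd (hns : ∀ w : PlacesOver L v, IsCMField.complexConj L • w.1 = w.1)
    [MeasurableSpace
        (↥(unitaryGroupOfForm (conjLocal L (IsCMField.complexConj L) v) (cmLocalForm L 3 v)) ⧸
          Subgroup.center ↥(unitaryGroupOfForm (conjLocal L (IsCMField.complexConj L) v) (cmLocalForm L 3 v)))]
    [BorelSpace
        (↥(unitaryGroupOfForm (conjLocal L (IsCMField.complexConj L) v) (cmLocalForm L 3 v)) ⧸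
          Subgroup.center ↥(unitaryGroupOfForm (conjLocal L (IsCMField.complexConj L) v) (cmLocalForm L 3 v)))]
    (μZ : Measure
        (↥(unitaryGroupOfForm (conjLocal L (IsCMField.complexConj L) v) (cmLocalForm L 3 v)) ⧸
          Subgroup.center ↥(unitaryGroupOfForm (conjLocal L (IsCMField.complexConj L) v) (cmLocalForm L 3 v))))
    [μZ.IsHaarMeasure] (V : Type) [AddCommGroup V] [Module ℂ V]
    (π : Representation ℂ ↥(unitaryGroupOfForm (conjLocal L (IsCMField.complexConj L) v) (cmLocalForm L 3 v)) V) (hπ : π.IsAdmissible)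
    (ω : ↥(Subgroup.center ↥(unitaryGroupOfForm (conjLocal L (IsCMField.complexConj L) v) (cmLocalForm L 3 v))) →* ℂˣ)
    (hω : ∀ (z : ↥(Subgroup.center ↥(unitaryGroupOfForm (conjLocal L (IsCMField.complexConj L) v) (cmLocalForm L 3 v)))) (x : V),
      π (z : ↥(unitaryGroupOfForm (conjLocal L (IsCMField.complexConj L) v) (cmLocalForm L 3 v))) x = ((ω z : ℂˣ) : ℂ) • x)
    (hω1 : ∀ z, ‖((ω z : ℂˣ) : ℂ)‖ = 1) :
    haveI := locallyCompactSpace_cmBorelU L 3 v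
    (∀ χ' : ↥(cmBorelTriple L 3 v).M →* ℂˣ, π.HasJacquetExponent (cmBorelTriple L 3 v) χ' →
        ∀ a : ↥(cmBorelTriple L 3 v).M,
          conjLocal L (IsCMField.complexConj L) v
              ((torusEntry (conjLocal L (IsCMField.complexConj L) v) (cmLocalForm L 3 v) 0 a : (UnitaryGroup.LocalRing L v)ˣ) : UnitaryGroup.LocalRing L v) =
            ((torusEntry (conjLocal L (IsCMField.complexConj L) v) (cmLocalForm L 3 v) 0 a : (UnitaryGroup.LocalRing L v)ˣ) : UnitaryGroup.LocalRing L v) →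
          torusEntry (conjLocal L (IsCMField.complexConj L) v) (cmLocalForm L 3 v) 1 a = 1 →
          unitModulusChar (UnitaryGroup.LocalRing L v) (torusEntry (conjLocal L (IsCMField.complexConj L) v) (cmLocalForm L 3 v) 0 a) < 1 →
          ‖((χ' a : ℂˣ) : ℂ)‖ < 1) →
      π.IsSquareIntegrableModCenter μZ := by
  intro hexp
  haveI := locallyCompactSpace_cmBorelU L 3 v
  haveI : LocallyCompactSpace ↥(unitaryGroupOfForm (conjLocal L (IsCMField.complexConj L) v) (cmLocalForm L 3 v)) := locallyCompactSpace_local (IsCMField.complexConj L) 3 _ v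
  obtain ⟨w⟩ := (inferInstance : Nonempty (PlacesOver L v))
  have hw : IsCMField.complexConj L • w.1 = w.1 := hns w
  -- a uniformiser of `L_w` and the torus ray `a`, `e a = d(ϖ, 1, (σ_w ϖ)⁻¹)`
  obtain ⟨ϖL, hϖL⟩ := w.1.valuation_exists_uniformizer L
  have hϖ : Valued.v ((ϖL : L) : w.1.adicCompletion L) = WithZero.exp (-1 : ℤ) := by
    rw [HeightOneSpectrum.valuedAdicCompletion_eq_valuation', hϖL]
  have hϖ0 : ((ϖL : L) : w.1.adicCompletion L) ≠ 0 := by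
    intro h
    rw [h, map_zero] at hϖ
    exact WithZero.exp_ne_zero hϖ.symm
  have hϖ1 : Valued.v ((ϖL : L) : w.1.adicCompletion L) < 1 := by
    rw [hϖ, ← WithZero.exp_zero]
    exact WithZero.exp_lt_exp.2 (by norm_num)
  obtain ⟨a, ha⟩ := exists_torus_coe_localNonsplitEquiv_eq_diagonal L v w hw hϖ0
  -- the CM Iwahori datum along `a` with the Cartan decomposition (T2)
  obtain ⟨𝓘, K₀, ⟨ha𝓘, hK₀c, hK₀o, hZK₀, hKle, hKK₀, haN, haNbar, hexh, hinj, -, hK₀iff⟩, hcartan⟩ :=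
    F0P3CMBorelIwahoriDatum.exists_cmIwahoriDatum_cartan L v w hw a hϖ0 hϖ ha
  -- the square `a² = b·k`
  obtain ⟨b, k, hsq, hb, hk⟩ := exists_sq_eq_mul_of_coe_localNonsplitEquiv_eq_diagonal L v w hw hϖ0 a ha
  have hsub : (⟨𝓘.a, 𝓘.a_mem⟩ : ↥(cmBorelTriple L 3 v).M) = a := Subtype.ext ha𝓘
  have hsq' : (⟨𝓘.a, 𝓘.a_mem⟩ : ↥(cmBorelTriple L 3 v).M) ^ 2 = b * k := by rw [hsub]; exact hsq
  -- `b` is admissible: the exponents decay on it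
  have hσσ : ∀ x, galAdicCompletionMap (L := L) (IsCMField.complexConj L) hw
      (galAdicCompletionMap (L := L) (IsCMField.complexConj L) hw x) = x :=
    galAdicCompletionMap_galAdicCompletionMap_of_smul_eq (IsCMField.complexConj L) w (IsCMField.complexConj_ne_one L) hw
  have hσv : ∀ x, Valued.v ((galAdicCompletionMap (L := L) (IsCMField.complexConj L) hw) x) = Valued.v x :=
    fun x => valued_galAdicCompletionMap (L := L) (IsCMField.complexConj L) hw x
  have hcond := n5Conditions_of_coe_localNonsplitEquiv_eq_diagonal L v w hw
    (map_mul_map_self (galAdicCompletionMap (L := L) (IsCMField.complexConj L) hw) hσσ _)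
    (v_mul_map_lt_one (galAdicCompletionMap (L := L) (IsCMField.complexConj L) hw) hσv hϖ1) b hb
  have hexpb : ∀ χ' : ↥(cmBorelTriple L 3 v).M →* ℂˣ, π.HasJacquetExponent (cmBorelTriple L 3 v) χ' → ‖((χ' b : ℂˣ) : ℂ)‖ < 1 :=
    fun χ' hχ => hexp χ' hχ b hcond.1 hcond.2.1 hcond.2.2
  -- `k ∈ K₀`, `δ^{1/2}(k) = 1`, and the compact `S = T ∩ K₀ ∋ k`
  have hkK₀ : (k : ↥(unitaryGroupOfForm (conjLocal L (IsCMField.complexConj L) v) (cmLocalForm L 3 v))) ∈ K₀ := (hK₀iff _).2 hk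
  have hδk : ‖((rootDeltaChar (cmBorelTriple L 3 v).P (Subgroup.inclusion (cmBorelTriple L 3 v).M_le k) : ℂˣ) : ℂ)‖ = 1 := by
    rw [rootDeltaChar_eq_one_of_mem_of_isClosed_of_isCompact _
      (isClosed_borelU (conjLocal L (IsCMField.complexConj L) v) (cmLocalForm L 3 v)) hK₀c hkK₀, Units.val_one, norm_one]
  -- the criterion
  exact Representation.isSquareIntegrableModCenter_of_forall_norm_exponent_lt_one_of_sq μZ hπ ω hω hω1 (cmBorelTriple L 3 v) 𝓘
    (isClosed_cmBorelTriple_N L v) (fun x y => torusU_mul_comm _ _ x y) K₀ hK₀c hK₀o hKK₀ haN haNbar hexh hcartan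
    (C := ((𝓘.K 0).relIndex K₀ : ℝ) *
      μZ.real ((QuotientGroup.mk : _ → ↥(unitaryGroupOfForm (conjLocal L (IsCMField.complexConj L) v) (cmLocalForm L 3 v)) ⧸
        Subgroup.center ↥(unitaryGroupOfForm (conjLocal L (IsCMField.complexConj L) v) (cmLocalForm L 3 v))) '' (K₀ : Set _)))
    (D := ((modularCharacter (⟨𝓘.a, (cmBorelTriple L 3 v).M_le 𝓘.a_mem⟩ : ↥(cmBorelTriple L 3 v).P) : ℝ≥0) : ℝ)⁻¹)
    (mul_nonneg (Nat.cast_nonneg _) measureReal_nonneg) (inv_nonneg.2 (NNReal.coe_nonneg _))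
    (measure_image_shell_le_cmIwahoriDatum L v μZ 𝓘 K₀ hK₀c hK₀o hZK₀ (hKle 0) (haN 0) (haNbar 0) hinj)
    (norm_rootDeltaChar_sq_mul_modularCharacter_inv _ _) b k hsq' (K₀.comap (cmBorelTriple L 3 v).M.subtype)
    ((isClosed_cmBorelTriple_M L v).isClosedEmbedding_subtypeVal.isCompact_preimage hK₀c) (Subgroup.mem_comap.2 hkK₀) hδk hexpb

/-- **N5 ★ `UnitaryGroup.U3SquareIntegrableExponents L` HOLDS** (Casselman's square-integrability criterion for `U(3)(L⁺_v)` at every non-split `v`,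
in the admissible-torus-element form of letter #109): ★ `u3SquareIntegrableExponents_of_perPlace` fed with `perPlace_fwd` and `perPlace_bwd`.
[cite: Casselman1995, Thm. 4.4.6 p. 45] [cite: Rogawski1990, §12.2 (2) p. 174] -/
theorem u3SquareIntegrableExponents_holds : U3SquareIntegrableExponents L :=
  u3SquareIntegrableExponents_of_perPlace L
    (fun v hns _ _ μZ _ V _ _ π hπ _ _ _ => perPlace_fwd L v hns μZ V π hπ)
    (fun v hns _ _ μZ _ V _ _ π hπ ω hω hω1 => perPlace_bwd L v hns μZ V π hπ ω hω hω1)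

end Summit.HodgeConjecture.HodgeConjecture.Cruxes.H413.F0P3U3SquareIntegrableExponentsHolds

end
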